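import Summits.ABC.IUTFork.ForkGenuineContent
import Literature.IUT.LogVolume.TensorPacketHullFieldMonotone
import HarnessLib

/-!
# The fork at [IUTchIII] Corollary 3.12 at a GENUINE input: the Θ-hull summand is EXACTLY `−min_a θ_j(v_a)` at an
# odd prime unramified in the completions (the window of `ForkGenuineContent` closes), and `(d_I − ⌊λ_min⌋)·log p`
# bounds it at tame tuples

abc-iut cell, prover seat abc-iut-w5-d036 (gen 5); sequel to abc-iut-skel's `ForkGenuineContent.lean` (p42xxxx: the
window `−min_a θ_j(v_a) ≤ log μ̄_{v⃗}(Θ-hull) ≤ −min_a θ_j(v_a) + {d_I + a_I + 1}·log p + log μ̄(hull(log_p(R_I^×)))` per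
summand of a genuine Θ-volume input) and to this seat's `Literature/IUT/LogVolume/TensorPacketHullFieldMonotone.lean`
(the (Ind2)-orbit hull of the (Ind1) slot-union has `log μ̄ = log‖g_{i₀}‖` at an odd UNRAMIFIED tuple, and
`≤ (d_I − ⌊λ_min⌋)·log p` at a TAME tuple). PROVED here, TAKING NO SIDE:

* `logμ_possibleImagesHull_le_of_tame` — at one summand `v⃗` of a real packet over a family of local fields `𝔽` (any
  shell normalisation `c`), if `p > 2` and every `e(𝔽_{v_b}) ≤ p − 2`:
  `log μ̄_{v⃗}(Θ-hull of the bare Θ-regions) ≤ (d_I − ⌊λ_min⌋)·log p` (`λ_min` = least order among the slots' Θ-values);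
* **`logμ_possibleImagesHull_eq_log_norm_of_unramified`** — if `p > 2` and every `e(𝔽_{v_b}) = 1`:
  `log μ̄_{v⃗}(Θ-hull) = log‖t_{j,v_{a₀}}‖` for a slot `a₀` of largest norm — the hull of the union of ALL possible images
  ((Ind1) slot-union, full (Ind2), holomorphic hull) has EXACTLY the log-volume of the bare Θ-region of the slot of
  LEAST order: no inflation at all at such a prime ([IUTchIV] Prop. 1.2 (iv), Thm. 1.10 Step (vi) "precisely equal";
  the `λ_min` reading of `HOME/plan/c312/STEPV-IND1-NOTE.md` §2, now exact in the kernel);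
* for a genuine Θ-volume input `I : ThetaVolumeInput F₀ K` at a prime `p > 2` at which every completion `K_{v̲}`,
  `v ∈ V(F₀)_p`, is unramified over `ℚ_p`: **`logμ_eq_neg_thetaMin_of_unramified`** — the summand at `(j, v⃗)` of
  `negLogThetaLoc p` equals `−min_a θ_j(v_a)` (`θ_j(v) = P_{Θ,j}(v)·ln|κ(v)|/n_v`), and
  **`negLogThetaLoc_eq_of_unramified`** — `negLogThetaLoc p = (1/ℓ⋇)·Σ_j Σ_{v⃗} (−min_a θ_j(v_a))·Π_b Pr(v_b)`:
  at such primes the Θ-side of [IUTchIII] Cor. 3.12 for the input is a CLOSED FORM in the Θ-pilot orders, with the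
  minimum over the slots (not the last slot, not the slot average) — the exact per-prime shape that the cell's RISK ¶7
  / `stub_hullRegime` discussion is about (non-slot-constant data lose exactly `min` vs `average`).

HONEST SCOPE. Theorems about the tree's typed objects at GENUINE inputs (sharp (Ind3)-datum, full (Ind2), the hull as
typed); wild or tamely-RAMIFIED primes keep the window of `ForkGenuineContent` (the exact tame content needs the
conductor of `⊗R_i` in `(R_I)^∼`, not in the tree). (Ind1)/(Ind2)/(Ind3), the hull and the possible images are the
tree's typings of constructions of the disputed corpus [claim: Mochizuki2012, status: disputed]; the lattice algebra
is classical. Nothing here asserts `Cor312Of` for any input or takes a side on [IUTchIII] Cor. 3.12; typed ≠ proved.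
PROOF-ONLY file: no definitions, no `Prop` facts. [cite: Mochizuki2012, IUTchIV Prop. 1.2 (ii)(iv) p. 10–11,
Thm 1.10 proof Step (v)–(vi) p. 27–29] [cite: DupuyHilado2025, Def. 3.6.3, §4.7, §4.9, §4.11, §4.12]
-/

noncomputable section

open Set Literature.IUT.LogVolume NumberField IsDedekindDomain
open scoped Pointwise

namespace Summit.ABC.IUTFork.GenuineContent

/-! ## 1. One summand of a real packet (any shell normalisation) -/

section Summand

variable {F : Type} [Field F] [NumberField F] {p : ℕ} [Fact p.Prime] (𝔽 : LocalFields F p)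
variable (c : (j : ℕ) → (Fin (j + 1) → placesOver F p) → ℚ_[p]) (hc0 : ∀ j e, c j e ≠ 0)
  (hcσ : ∀ (j : ℕ) (σ : Equiv.Perm (Fin (j + 1))) (e : Fin (j + 1) → placesOver F p), c j (e ∘ σ) = c j e)
variable {lstar : ℕ} (t : Fin lstar → (v : placesOver F p) → (𝔽.k v)ˣ) (i : Fin lstar)
  (e : Fin ((i : ℕ) + 1 + 1) → placesOver F p)

/-- **Tame closed form of the upper end at one summand**: if `p > 2` and every `e(𝔽_{v_b}) ≤ p − 2`, then for orders
`m_a` of the slots' Θ-values (`‖t_{j,v_a}‖ = p^{−m_a/e_a}`) and a slot `a₀` of least order `λ_min = m_{a₀}/e_{a₀}`,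
`log μ̄_{v⃗}(Θ-hull of the bare Θ-regions) ≤ (d_I − ⌊λ_min⌋)·log p` ([IUTchIV] Prop. 1.2 (ii) at `φ = id`, the tame
values `d_I + a_I = |I|`, `log μ̄(hull(log_p(R_I^×))) = −a_I·log p`). [cite: Mochizuki2012, IUTchIV Prop. 1.2 (ii) p. 10, Prop. 1.4 (iii) p. 13] -/
theorem logμ_possibleImagesHull_le_of_tame (hp : 2 < p) (he : ∀ b, absRamificationIdx p (𝔽.k (e b)) ≤ p - 2)
    (mexp : Fin ((i : ℕ) + 1 + 1) → ℤ)
    (hmexp : ∀ a, ‖(t i (e a) : 𝔽.k (e a))‖ = (p : ℝ) ^ (-((mexp a : ℝ) / absRamificationIdx p (𝔽.k (e a)))))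
    (a₀ : Fin ((i : ℕ) + 1 + 1))
    (hmin : ∀ a, (mexp a₀ : ℝ) / absRamificationIdx p (𝔽.k (e a₀)) ≤ (mexp a : ℝ) / absRamificationIdx p (𝔽.k (e a))) :
    (realPrimePacketWith p 𝔽 c hc0 hcσ).logμ ((realPrimePacketWith p 𝔽 c hc0 hcσ).possibleImagesHull
        ((realPrimePacketWith p 𝔽 c hc0 hcσ).pilotRegion t) ((i : ℕ) + 1) e) ≤
      (dSum p (fun b => 𝔽.k (e b)) - ⌊(mexp a₀ : ℝ) / absRamificationIdx p (𝔽.k (e a₀))⌋) * Real.log p := by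
  have hI : 2 ≤ Fintype.card (Fin ((i : ℕ) + 1 + 1)) := by simp
  rw [possibleImagesHull_pilotRegion_eq]
  show packetLogμ p (fun b => 𝔽.k (e b)) _ ≤ _
  exact packetLogμ_packetHull_orbit_le_of_tame p (fun b => 𝔽.k (e b)) hI hp he (isPsiBounded_slotUnion 𝔽 t i e)
    (exists_ne_zero_mem_slotUnion 𝔽 t i e) (fun a => (t i (e a) : 𝔽.k (e a))) mexp hmexp a₀ hmin Subset.rfl

/-- **Unramified exact value at one summand**: if `p > 2` and every `e(𝔽_{v_b}) = 1`, then for a slot `a₀` of largest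
norm, `log μ̄_{v⃗}(Θ-hull of the bare Θ-regions) = log‖t_{j,v_{a₀}}‖` — the window of `ForkGenuineContent`
(`log_norm_le_logμ_possibleImagesHull` / `logμ_possibleImagesHull_le`) CLOSES at an odd unramified tuple.
[cite: Mochizuki2012, IUTchIV Prop. 1.2 (iv) p. 11, Thm 1.10 proof Step (vi) p. 29] [cite: DupuyHilado2025, §4.7, §4.12] -/
theorem logμ_possibleImagesHull_eq_log_norm_of_unramified (hp : 2 < p)
    (he : ∀ b, absRamificationIdx p (𝔽.k (e b)) = 1) (a₀ : Fin ((i : ℕ) + 1 + 1))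
    (hmax : ∀ a, ‖(t i (e a) : 𝔽.k (e a))‖ ≤ ‖(t i (e a₀) : 𝔽.k (e a₀))‖) :
    (realPrimePacketWith p 𝔽 c hc0 hcσ).logμ ((realPrimePacketWith p 𝔽 c hc0 hcσ).possibleImagesHull
        ((realPrimePacketWith p 𝔽 c hc0 hcσ).pilotRegion t) ((i : ℕ) + 1) e) =
      Real.log ‖(t i (e a₀) : 𝔽.k (e a₀))‖ := by
  have hI : 2 ≤ Fintype.card (Fin ((i : ℕ) + 1 + 1)) := by simp
  choose mexp hmexp using fun a => exists_norm_eq_rpow p (𝔽.k (e a)) (t i (e a)).ne_zero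
  have hmin : ∀ a, (mexp a₀ : ℝ) / absRamificationIdx p (𝔽.k (e a₀)) ≤
      (mexp a : ℝ) / absRamificationIdx p (𝔽.k (e a)) :=
    fun a => slotOrder_le_of_norm_le p (fun b => 𝔽.k (e b)) (hmexp a) (hmexp a₀) (hmax a)
  rw [possibleImagesHull_pilotRegion_eq]
  show packetLogμ p (fun b => 𝔽.k (e b)) _ = _
  exact packetLogμ_packetHull_orbit_slotUnion_eq_of_unramified p (fun b => 𝔽.k (e b)) hI hp he
    (fun a => (t i (e a) : 𝔽.k (e a))) mexp hmexp a₀ hmin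

end Summand

/-! ## 2. The genuine input at an odd prime unramified in the completions -/

section Input

variable {F₀ : Type} [Field F₀] [NumberField F₀] {K : Type} [Field K] [NumberField K] [Algebra F₀ K]
variable (I : ThetaVolumeInput F₀ K)

/-- **The summand of `−|log(Θ)|` at `(p, j, v⃗)` for a genuine input is EXACTLY `−min_a θ_j(v_a)`** when `p > 2` and
every completion of the input's local-field family over `p` is unramified over `ℚ_p`
(`θ_j(v) := P_{Θ,j}(v)·ln|κ(v)|/n_v`). [cite: Mochizuki2012, IUTchIV Prop. 1.2 (iv) p. 11, Thm 1.10 proof Step (v)–(vi) p. 27–29]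
[cite: DupuyHilado2025, Def. 3.6.3, §4.11–4.12] -/
theorem logμ_eq_neg_thetaMin_of_unramified {p : ℕ} [hp : Fact p.Prime] (hp2 : 2 < p)
    (he : ∀ v : placesOver F₀ p, absRamificationIdx p ((I.σ.localFieldFamily p hp.out).k v) = 1)
    (i : Fin I.X.lstar) (e : Fin ((i : ℕ) + 1 + 1) → placesOver F₀ p) :
    (realPrimePacketM p (I.σ.localFieldFamily p hp.out)).logμ
        ((realPrimePacketM p (I.σ.localFieldFamily p hp.out)).possibleImagesHull
          ((realPrimePacketM p (I.σ.localFieldFamily p hp.out)).pilotRegion (I.tΘ p hp.out))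
            ((i : ℕ) + 1) e) =
      -(Finset.univ.inf' ⟨0, Finset.mem_univ _⟩ (fun a =>
          I.X.thetaPilot i (e a).1 * logNorm F₀ (e a).1 / localDegree F₀ (e a).1)) := by
  obtain ⟨a₀, -, ha₀⟩ := Finset.exists_mem_eq_inf' (⟨0, Finset.mem_univ _⟩ : (Finset.univ :
    Finset (Fin ((i : ℕ) + 1 + 1))).Nonempty)
    (fun a => I.X.thetaPilot i (e a).1 * logNorm F₀ (e a).1 / localDegree F₀ (e a).1)
  have hmin : ∀ a, I.X.thetaPilot i (e a₀).1 * logNorm F₀ (e a₀).1 / localDegree F₀ (e a₀).1 ≤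
      I.X.thetaPilot i (e a).1 * logNorm F₀ (e a).1 / localDegree F₀ (e a).1 := fun a => by
    rw [← ha₀]
    exact Finset.inf'_le _ (Finset.mem_univ a)
  have hmax : ∀ a, ‖(I.tΘ p hp.out i (e a) : (I.σ.localFieldFamily p hp.out).k (e a))‖ ≤
      ‖(I.tΘ p hp.out i (e a₀) : (I.σ.localFieldFamily p hp.out).k (e a₀))‖ := by
    intro a
    rw [← Real.log_le_log_iff (norm_pos_iff.mpr (I.tΘ p hp.out i (e a)).ne_zero)
      (norm_pos_iff.mpr (I.tΘ p hp.out i (e a₀)).ne_zero), log_norm_tΘ, log_norm_tΘ]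
    exact neg_le_neg (hmin a)
  have h := logμ_possibleImagesHull_eq_log_norm_of_unramified (I.σ.localFieldFamily p hp.out)
    (mScale p (I.σ.localFieldFamily p hp.out)) (mScale_ne_zero p (I.σ.localFieldFamily p hp.out))
    (mScale_perm p (I.σ.localFieldFamily p hp.out)) (I.tΘ p hp.out) i e hp2 (fun b => he (e b)) a₀ hmax
  rw [log_norm_tΘ] at h
  rw [ha₀]
  exact h

/-- **`negLogThetaLoc p` in CLOSED FORM at an odd prime unramified in the completions**:
`negLogThetaLoc p = (1/ℓ⋇)·Σ_{j=1}^{ℓ⋇} Σ_{v⃗ ∈ V(F₀)_p^{j+1}} (−min_a θ_j(v_a))·Π_b Pr(v_b)` — Dupuy–Hilado Def. 3.6.3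
with every Θ-hull summand evaluated exactly (minimum over the slots; not the last slot, not the slot average).
[cite: DupuyHilado2025, Def. 3.6.3, §4.11–4.12] [cite: Mochizuki2012, IUTchIV Thm 1.10 proof Step (v)–(vi) p. 27–29] -/
theorem negLogThetaLoc_eq_of_unramified {p : ℕ} [hp : Fact p.Prime] (hp2 : 2 < p)
    (he : ∀ v : placesOver F₀ p, absRamificationIdx p ((I.σ.localFieldFamily p hp.out).k v) = 1) :
    I.negLogThetaLoc p =
      (1 / (I.X.lstar : ℝ)) * ∑ i : Fin I.X.lstar, ∑ e : Fin ((i : ℕ) + 1 + 1) → placesOver F₀ p,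
        -(Finset.univ.inf' ⟨0, Finset.mem_univ _⟩ (fun a =>
            I.X.thetaPilot i (e a).1 * logNorm F₀ (e a).1 / localDegree F₀ (e a).1)) *
          ∏ b, weight F₀ (e b).1 := by
  rw [negLogThetaLoc_eq_sum]
  refine congrArg _ (Finset.sum_congr rfl fun i _ => Finset.sum_congr rfl fun e _ => ?_)
  rw [logμ_eq_neg_thetaMin_of_unramified I hp2 he i e]

/-- The same closed form bounded ABOVE BY THE LAST-SLOT form: since `min_a θ_j(v_a) ≤ θ_j(v_j)` and the weights are
nonnegative, `negLogThetaLoc p ≥ (1/ℓ⋇)·Σ_j Σ_{v⃗} (−θ_j(v_j))·Π_b Pr(v_b)` — the exact Θ-side is at least the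
print-shaped "`i† = j`" expression of [IUTchIV] Thm. 1.10 Step (v), with equality iff the minimum is attained at the last
slot on every weighted summand. [cite: Mochizuki2012, IUTchIV Thm 1.10 proof Step (v) p. 27–28] -/
theorem lastSlot_sum_le_negLogThetaLoc_of_unramified {p : ℕ} [hp : Fact p.Prime] (hp2 : 2 < p)
    (he : ∀ v : placesOver F₀ p, absRamificationIdx p ((I.σ.localFieldFamily p hp.out).k v) = 1) :
    (1 / (I.X.lstar : ℝ)) * ∑ i : Fin I.X.lstar, ∑ e : Fin ((i : ℕ) + 1 + 1) → placesOver F₀ p,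
        -(I.X.thetaPilot i (e (Fin.last _)).1 * logNorm F₀ (e (Fin.last _)).1 / localDegree F₀ (e (Fin.last _)).1) *
          ∏ b, weight F₀ (e b).1 ≤
      I.negLogThetaLoc p := by
  rw [negLogThetaLoc_eq_of_unramified I hp2 he]
  have hl : (0 : ℝ) ≤ 1 / (I.X.lstar : ℝ) := by positivity
  refine mul_le_mul_of_nonneg_left (Finset.sum_le_sum fun i _ => Finset.sum_le_sum fun e _ => ?_) hl
  refine mul_le_mul_of_nonneg_right (neg_le_neg (Finset.inf'_le _ (Finset.mem_univ _)))
    (Finset.prod_nonneg fun b _ => weight_nonneg F₀ _)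

end Input

end Summit.ABC.IUTFork.GenuineContent

end
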